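import Summits.AnomalousDissipation.AnomalousDissipation.Theorems.EnsembleRigidityDefs
import Summits.AnomalousDissipation.AnomalousDissipation.Theorems.EnsembleRigidityGPMeanBoundedFamilyStubHeadModes
import Literature.Analysis.FluidPDE.NSHopfInvariant

/-!
# Stub `stub_symmetricScheme` of line `Sketch` (crux stmt-AnomalousDissipation-15509,
  `EnsembleRigidity.GPMeanBoundedFamily`)

S5 of the skeleton `Theorems/EnsembleRigidity/GPMeanBoundedFamily`: for every `ν > 0` a Hopf–Galerkin
scheme (`IsHopfGalerkinScheme`) for the Navier–Stokes equations on `T³` forced by the steady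
Galloway–Proctor force `f_GP = gpForce` from rest, all of whose approximants are `G`-symmetric
(`IsGPSymmetric`). Pattern `NSHopfInvariant.exists_isHopfGalerkinScheme_invariant` (Hopf 1951, §§2–3;
Robinson–Rodrigo–Sadowski 2016, Thm. 4.4 Steps 1–2, run in a closed invariant subspace):
* the three generators of `G` are affine maps `A y = (ε_j y_{σ j} + b_j)_j` of `T³` (`σ` a coordinate
  permutation, `ε_j = ±1`) acting on values by `(Qv)_i = ε_i v_{σ i}`; for a continuous field,
  covariance `u ∘ A = Q ∘ u` is EQUIVALENT to the twisted relation `û(Qk) = e_{-Qk}(b) Q û(k)`,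
  `(Qk)_j = ε_j k_{σ j}`, on Fourier coefficients (`mFourierCoeff_of_symmetric`,
  `symmetric_of_mFourierCoeff`: `A` preserves Haar measure, `e_{Qk}(A y) = e_{Qk}(b) e_k(y)`, Fourier
  uniqueness `Torus.ae_eq_of_mFourierCoeff_complexify_eq`);
* the Fourier–Galerkin vector field preserves the twisted relation (`galerkinField_signedPerm`:
  `|Qk|² = |k|²`, the Leray symbol is `Q`-covariant, the convection symbol is covariant after
  reindexing by `Q`, the phases being multiplicative), so `exists_galerkin_solution_of_invariant` runs
  in `galerkinSubspace ⊓ {twisted relation}` with the (covariant, real) force coefficients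
  `f̂_GP|_{|k| ≤ n}` and datum `0` (`exists_symmetric_scheme`, any dimension, any finite list of such
  symmetries of a smooth steady force); `f_GP` is `G`-symmetric by `StubHeadModes.isGPSymmetric_gpForce`.
-/

noncomputable section

-- every `Summit.AnomalousDissipation.AnomalousDissipation.…` name repeats the summit = sub-problem segment (D-0017 layout)
set_option linter.dupNamespace false

namespace Summit.AnomalousDissipation.AnomalousDissipation.Theorems.EnsembleRigidity.GPMeanBoundedFamily

open MeasureTheory Filter Topology Set UnitAddTorus
open Literature.Analysis.FunctionSpaces Literature.Analysis.FluidPDE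
open Summit.AnomalousDissipation.AnomalousDissipation.Theorems.EnsembleRigidity

namespace StubSymmetricScheme

/-! ## Signed coordinate permutations `(Qk)_j = ε_j k_{σ j}` and the affine maps
`A y = (ε_j y_{σ j} + b_j)_j`: Fourier side -/

section Symmetry

variable {d : Type*} [Fintype d] (σ : Equiv.Perm d) {ε : d → ℤ} {Q : (d → ℤ) → (d → ℤ)}
  (hε : ∀ j, ε j = 1 ∨ ε j = -1) (hQ : ∀ k j, Q k j = ε j * k (σ j))

include hε hQ

/-- `|Qk|² = |k|²`. [folklore] -/
theorem freqNormSq_signedPerm (k : d → ℤ) : Torus.freqNormSq (Q k) = Torus.freqNormSq k := by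
  simp only [Torus.freqNormSq, hQ, Int.cast_mul, mul_pow]
  rw [← Equiv.sum_comp σ (fun j => (k j : ℝ) ^ 2)]
  refine Finset.sum_congr rfl fun j _ => ?_
  rw [show ((ε j : ℝ)) ^ 2 = 1 by rcases hε j with h | h <;> simp [h], one_mul]

/-- **The Galerkin vector field is covariant** under a signed coordinate permutation `Q` of a
`Q`-stable frequency set `S`, twisted by a multiplicative phase `φ`: if `g (Qk) = φ k · Q (g k)`,
`c (Qk) = φ k · Q (c k)` componentwise, so does `galerkinField ν S g c` (the Stokes multiplier sees
`|k|² = |Qk|²`, `Π_{Qk} Q = Q Π_k`, the convection symbol is reindexed by `Q`). [folklore] -/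
theorem galerkinField_signedPerm (ν : ℝ) {S : Finset (d → ℤ)} (hS : ∀ k, Q k ∈ S ↔ k ∈ S)
    {φ : (d → ℤ) → ℂ} (hφ : ∀ l m, φ (l + m) = φ l * φ m) {g c : (d → ℤ) → EuclideanSpace ℂ d}
    (hg : ∀ k i, g (Q k) i = φ k * ((ε i : ℂ) * g k (σ i)))
    (hc : ∀ k i, c (Q k) i = φ k * ((ε i : ℂ) * c k (σ i))) (k : d → ℤ) (i : d) :
    Torus.galerkinField ν S g c (Q k) i =
      φ k * ((ε i : ℂ) * Torus.galerkinField ν S g c k (σ i)) := by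
  have hεsq : ∀ j, ε j * ε j = 1 := fun j => by rcases hε j with h | h <;> simp [h]
  have hεC : ∀ j, (ε j : ℂ) * ε j = 1 := fun j => by exact_mod_cast hεsq j
  -- the convection symbol: reindex by `Q`, a bijection of `S` with inverse `Q'`
  have hQinv : ∀ k, Q (fun j => ε (σ.symm j) * k (σ.symm j)) = k := fun k => by
    funext j; rw [hQ, Equiv.symm_apply_apply, ← mul_assoc, hεsq, one_mul]
  have hinvQ : ∀ k : d → ℤ, (fun j => ε (σ.symm j) * Q k (σ.symm j)) = k := fun k => by
    funext j; rw [hQ, Equiv.apply_symm_apply, ← mul_assoc, hεsq, one_mul]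
  have hQadd : ∀ l m, Q (l + m) = Q l + Q m := fun l m => by
    funext j; simp only [hQ, Pi.add_apply, mul_add]
  have hQinj : ∀ l m, Q l = Q m ↔ l = m := fun l m =>
    ⟨fun h => by rw [← hinvQ l, ← hinvQ m, h], fun h => by rw [h]⟩
  have hS' : ∀ k, (fun j => ε (σ.symm j) * k (σ.symm j)) ∈ S ↔ k ∈ S := fun k => by
    rw [← hS, hQinv]
  have happly : ∀ (K : d → ℤ) (i : d), Torus.convectionCoeff S c c K i = ∑ l ∈ S, ∑ m ∈ S,
      if l + m = K then (2 * Real.pi * Complex.I * ∑ j, c l j * (m j : ℂ)) * c m i else 0 := by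
    intro K i
    simp only [Torus.convectionCoeff_def, WithLp.ofLp_sum, Finset.sum_apply]
    refine Finset.sum_congr rfl fun l _ => Finset.sum_congr rfl fun m _ => ?_
    split_ifs <;> simp
  have hconv : ∀ i, Torus.convectionCoeff S c c (Q k) i =
      φ k * ((ε i : ℂ) * Torus.convectionCoeff S c c k (σ i)) := by
    intro i
    rw [happly, happly]
    simp only [Finset.mul_sum, mul_ite, mul_zero]
    symm
    refine Finset.sum_nbij' Q (fun l j => ε (σ.symm j) * l (σ.symm j)) (fun l hl => (hS l).2 hl)
      (fun l hl => (hS' l).2 hl) (fun l _ => hinvQ l) (fun l _ => hQinv l) fun l _ => ?_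
    refine Finset.sum_nbij' Q (fun m j => ε (σ.symm j) * m (σ.symm j)) (fun m hm => (hS m).2 hm)
      (fun m hm => (hS' m).2 hm) (fun m _ => hinvQ m) (fun m _ => hQinv m) fun m _ => ?_
    simp only [← hQadd, hQinj]
    split_ifs with hlm
    · have hin : ∑ j, 2 * (Real.pi : ℂ) * Complex.I * (c (Q l) j * ((Q m j : ℤ) : ℂ)) =
          φ l * ∑ j, 2 * (Real.pi : ℂ) * Complex.I * (c l j * (m j : ℂ)) := by
        rw [← Equiv.sum_comp σ (fun j => 2 * (Real.pi : ℂ) * Complex.I * (c l j * (m j : ℂ))),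
          Finset.mul_sum]
        refine Finset.sum_congr rfl fun j _ => ?_
        rw [hc, hQ, Int.cast_mul]
        linear_combination 2 * (Real.pi : ℂ) * Complex.I * φ l * c l (σ j) * (m (σ j) : ℂ) * hεC j
      rw [hin, hc m i, ← hlm, hφ]
      ring
    · rfl
  -- the Leray symbol and the Stokes multiplier
  have hsum : ∑ j, ((Q k j : ℤ) : ℂ) * (g (Q k) j - Torus.convectionCoeff S c c (Q k) j) =
      φ k * ∑ j, (k j : ℂ) * (g k j - Torus.convectionCoeff S c c k j) := by
    rw [← Equiv.sum_comp σ (fun j => (k j : ℂ) * (g k j - Torus.convectionCoeff S c c k j)),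
      Finset.mul_sum]
    refine Finset.sum_congr rfl fun j _ => ?_
    rw [hQ, hg, hconv, Int.cast_mul]
    linear_combination (k (σ j) : ℂ) * φ k * (g k (σ j) - Torus.convectionCoeff S c c k (σ j)) *
      hεC j
  simp only [Torus.galerkinField_def, Torus.leraySym_def, PiLp.add_apply, PiLp.neg_apply,
    PiLp.sub_apply, PiLp.smul_apply, Torus.freqVec_apply, smul_eq_mul]
  rw [hsum, freqNormSq_signedPerm σ hε hQ k, hQ k i, hg k i, hc k i, hconv i, Int.cast_mul]
  ring

/-- **Fourier coefficients of a pull-back along `A`**: `𝓕(g ∘ A)(k) = e_{Qk}(b) 𝓕g(Qk)` for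
continuous `g : T^d → ℂ` — `A` preserves Haar measure (coordinate permutation, reflections,
translation), and `e_{Qk}(A y) = e_{Qk}(b) e_k(y)` (`e_n(ε x) = e_{nε}(x)`, `ε² = 1`). [folklore] -/
theorem mFourierCoeff_comp_affine (b : UnitAddTorus d) {g : UnitAddTorus d → ℂ} (hg : Continuous g)
    (k : d → ℤ) : mFourierCoeff (fun y => g (fun j => ε j • y (σ j) + b j)) k =
      mFourier (Q k) b * mFourierCoeff g (Q k) := by
  have hεsq : ∀ j, ε j * ε j = 1 := fun j => by rcases hε j with h | h <;> simp [h]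
  -- `A` is measure preserving
  have hA : MeasurePreserving (fun y : UnitAddTorus d => fun j => ε j • y (σ j) + b j) volume
      volume := by
    have h1 : MeasurePreserving (⇑(MeasurableEquiv.piCongrLeft (fun _ : d => UnitAddCircle) σ.symm) :
        UnitAddTorus d → UnitAddTorus d) volume volume :=
      volume_measurePreserving_piCongrLeft (fun _ : d => UnitAddCircle) σ.symm
    rw [show (⇑(MeasurableEquiv.piCongrLeft (fun _ : d => UnitAddCircle) σ.symm) :
        UnitAddTorus d → UnitAddTorus d) = fun y j => y (σ j) by
      funext y j; simp [MeasurableEquiv.coe_piCongrLeft, Equiv.piCongrLeft_apply_eq_cast]] at h1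
    have hj : ∀ j, MeasurePreserving (fun x : UnitAddCircle => ε j • x) volume volume := fun j => by
      rcases hε j with h | h
      · simp only [h, one_zsmul]; exact MeasurePreserving.id volume
      · simp only [h, neg_one_zsmul]; exact Measure.measurePreserving_neg volume
    exact ((measurePreserving_add_right volume b).comp (volume_preserving_pi hj)).comp h1
  -- characters: `e_{-k}(y) = e_{Qk}(b) e_{-Qk}(A y)`
  have hchar : ∀ y : UnitAddTorus d, mFourier (-k) y =
      mFourier (Q k) b * mFourier (-Q k) (fun j => ε j • y (σ j) + b j) := by
    intro y
    have h : mFourier (-Q k) (fun j => ε j • y (σ j) + b j) = mFourier (-Q k) b * mFourier (-k) y := by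
      simp only [mFourier, ContinuousMap.coe_mk, Pi.neg_apply]
      rw [← Equiv.prod_comp σ (fun j => fourier (-k j) (y j)), ← Finset.prod_mul_distrib]
      refine Finset.prod_congr rfl fun j _ => ?_
      rw [Torus.fourier_apply_add, hQ, mul_comm, fourier_apply (x := ε j • y (σ j)), smul_smul,
        show -(ε j * k (σ j)) * ε j = -k (σ j) by linear_combination -k (σ j) * hεsq j, ← fourier_apply]
    rw [h, ← mul_assoc, ← mFourier_add, add_neg_cancel, mFourier_zero, ContinuousMap.one_apply,
      one_mul]
  rw [Torus.mFourierCoeff_eq_integral_volume, Torus.mFourierCoeff_eq_integral_volume]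
  simp_rw [hchar, smul_eq_mul, mul_assoc]
  rw [integral_const_mul]
  congr 1
  rw [← integral_map (f := fun z => mFourier (-Q k) z * g z) hA.measurable.aemeasurable (by
    rw [hA.map_eq]; exact ((mFourier (-Q k)).continuous.mul hg).aestronglyMeasurable), hA.map_eq]

/-- **Twisted covariance of the Fourier coefficients of a symmetric field**: if `u : T^d → ℝ^d`
is continuous with `u (A y) i = ε_i u y (σ i)`, then `û (Qk) i = e_{-Qk}(b) ε_i û k (σ i)`.
[folklore] -/
theorem mFourierCoeff_of_symmetric (b : UnitAddTorus d) {u : UnitAddTorus d → EuclideanSpace ℝ d}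
    (hu : Continuous u) (hsym : ∀ y i, u (fun j => ε j • y (σ j) + b j) i = (ε i : ℝ) * u y (σ i))
    (k : d → ℤ) (i : d) : mFourierCoeff (EuclideanSpace.complexify ∘ u) (Q k) i =
      mFourier (-Q k) b * ((ε i : ℂ) * mFourierCoeff (EuclideanSpace.complexify ∘ u) k (σ i)) := by
  have h := mFourierCoeff_comp_affine σ hε hQ b (g := fun y => (u y i : ℂ))
    (Complex.continuous_ofReal.comp ((EuclideanSpace.proj i).continuous.comp hu)) k
  rw [show (fun y : UnitAddTorus d => ((u (fun j => ε j • y (σ j) + b j) i : ℝ) : ℂ)) =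
      (ε i : ℂ) • fun y => (u y (σ i) : ℂ) by
        funext y; simp only [Pi.smul_apply, smul_eq_mul, hsym]; push_cast; ring,
    Torus.mFourierCoeff_const_smul, smul_eq_mul] at h
  rw [Torus.mFourierCoeff_complexify_apply hu.integrable_unitAddTorus,
    Torus.mFourierCoeff_complexify_apply hu.integrable_unitAddTorus, h, ← mul_assoc, ← mFourier_add,
    neg_add_cancel, mFourier_zero, ContinuousMap.one_apply, one_mul]

/-- **Symmetry from twisted covariance** (converse of `mFourierCoeff_of_symmetric`): `u ∘ A` and
`Q ∘ u` are continuous with the same Fourier coefficients, hence equal (Fourier uniqueness in `L²`,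
then continuity). [folklore] -/
theorem symmetric_of_mFourierCoeff (b : UnitAddTorus d) {u : UnitAddTorus d → EuclideanSpace ℝ d}
    (hu : Continuous u) (hfix : ∀ k i, mFourierCoeff (EuclideanSpace.complexify ∘ u) (Q k) i =
      mFourier (-Q k) b * ((ε i : ℂ) * mFourierCoeff (EuclideanSpace.complexify ∘ u) k (σ i)))
    (y : UnitAddTorus d) (i : d) : u (fun j => ε j • y (σ j) + b j) i = (ε i : ℝ) * u y (σ i) := by
  set w : UnitAddTorus d → EuclideanSpace ℝ d :=
    fun y => WithLp.toLp 2 fun i => (ε i : ℝ) * u y (σ i) with hw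
  have hvc : Continuous fun y : UnitAddTorus d => u (fun j => ε j • y (σ j) + b j) :=
    hu.comp (continuous_pi fun j => ((continuous_apply (σ j)).zsmul (ε j)).add continuous_const)
  have hwc : Continuous w := (PiLp.continuous_toLp 2 _).comp (continuous_pi fun i =>
    continuous_const.mul ((EuclideanSpace.proj (σ i)).continuous.comp hu))
  have hae : (fun y : UnitAddTorus d => u (fun j => ε j • y (σ j) + b j)) =ᵐ[volume] w := by
    refine Literature.Analysis.FluidPDE.Torus.ae_eq_of_mFourierCoeff_complexify_eq
      (hvc.memLp_of_hasCompactSupport (HasCompactSupport.of_compactSpace _))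
      (hwc.memLp_of_hasCompactSupport (HasCompactSupport.of_compactSpace w)) fun k => ?_
    ext i
    have hf := hfix k i
    rw [Torus.mFourierCoeff_complexify_apply hu.integrable_unitAddTorus,
      Torus.mFourierCoeff_complexify_apply hu.integrable_unitAddTorus] at hf
    rw [Torus.mFourierCoeff_complexify_apply hvc.integrable_unitAddTorus,
      Torus.mFourierCoeff_complexify_apply hwc.integrable_unitAddTorus,
      show (fun y => ((w y i : ℝ) : ℂ)) = (ε i : ℂ) • fun y => (u y (σ i) : ℂ) by funext y; simp [hw],
      Torus.mFourierCoeff_const_smul, smul_eq_mul,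
      mFourierCoeff_comp_affine σ hε hQ b (g := fun y => (u y i : ℂ))
        (Complex.continuous_ofReal.comp ((EuclideanSpace.proj i).continuous.comp hu)), hf,
      ← mul_assoc, ← mFourier_add, add_neg_cancel, mFourier_zero, ContinuousMap.one_apply, one_mul]
  have hy := congrFun ((Continuous.ae_eq_iff_eq volume hvc hwc).1 hae) y
  simp only [hw] at hy
  rw [hy, PiLp.toLp_apply]

end Symmetry

/-! ## The symmetric Hopf–Galerkin scheme -/

/-- **Hopf–Galerkin scheme in a symmetry class** (Hopf 1951, §§2–3; Robinson–Rodrigo–Sadowski 2016,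
Thm. 4.4 Steps 1–2, run in a closed invariant subspace as in `exists_isHopfGalerkinScheme_invariant`):
for `ν > 0`, a smooth steady force `f` on `T^d` and a finite list `G` of affine symmetries
`A y = (ε_j y_{σ j} + b_j)_j` (`ε = ±1`) with `f (A y) i = ε_i f y (σ i)`, a Hopf–Galerkin scheme for
`(ν, f, 0)` whose approximants are covariant under every `A ∈ G` — force coefficients `f̂|_{|k| ≤ n}`,
states in `galerkinSubspace ⊓ {c | ĉ(Qk) = e_{-Qk}(b) Q ĉ(k), A ∈ G}` (`galerkinField_signedPerm`),
covariance read off by `symmetric_of_mFourierCoeff`. [folklore] -/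
theorem exists_symmetric_scheme {d : Type*} [Fintype d] [DecidableEq d] (ν : ℝ) (hν : 0 < ν)
    (G : List (Equiv.Perm d × (d → ℤ) × UnitAddTorus d))
    (hG : ∀ p ∈ G, ∀ j, p.2.1 j = 1 ∨ p.2.1 j = -1) {f : UnitAddTorus d → EuclideanSpace ℝ d}
    (hf : Torus.IsSmooth f) (hfG : ∀ p ∈ G, ∀ (y : UnitAddTorus d) (i : d),
      f (fun j => p.2.1 j • y (p.1 j) + p.2.2 j) i = (p.2.1 i : ℝ) * f y (p.1 i)) :
    ∃ (N : ℕ → ℕ) (F U : ℕ → ℝ → UnitAddTorus d → EuclideanSpace ℝ d),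
      IsHopfGalerkinScheme ν (fun _ => f) 0 N F U ∧ ∀ n (t : ℝ), ∀ p ∈ G,
        ∀ (y : UnitAddTorus d) (i : d),
          U n t (fun j => p.2.1 j • y (p.1 j) + p.2.2 j) i = (p.2.1 i : ℝ) * U n t y (p.1 i) := by
  have hS : ∀ n : ℕ, ∀ k ∈ Torus.freqBall (d := d) n, -k ∈ Torus.freqBall n := fun n =>
    Torus.neg_mem_freqBall_of_mem
  have hSQ : ∀ p ∈ G, ∀ (n : ℕ) (k : d → ℤ),
      (fun j => p.2.1 j * k (p.1 j)) ∈ Torus.freqBall n ↔ k ∈ Torus.freqBall n := fun p hp n k => by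
    rw [Torus.mem_freqBall, Torus.mem_freqBall,
      freqNormSq_signedPerm p.1 (hG p hp) (Q := fun k j => p.2.1 j * k (p.1 j)) (fun _ _ => rfl)]
  have hφ : ∀ p ∈ G, ∀ l m : d → ℤ, mFourier (-fun j => p.2.1 j * (l + m) (p.1 j)) p.2.2 =
      mFourier (-fun j => p.2.1 j * l (p.1 j)) p.2.2 * mFourier (-fun j => p.2.1 j * m (p.1 j)) p.2.2 := by
    intro p _ l m
    rw [← mFourier_add]
    exact congrArg (mFourier · p.2.2) (funext fun j => by simp only [Pi.neg_apply, Pi.add_apply]; ring)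
  -- the force coefficients `f̂|_{|k| ≤ n}`: real, and their extension by zero is covariant
  set g' : (n : ℕ) → ℝ → (↥(Torus.freqBall (d := d) n) → EuclideanSpace ℂ d) :=
    fun n _ k => mFourierCoeff (EuclideanSpace.complexify ∘ f) k with hg'
  have hg'_real : ∀ n t, Torus.IsRealCoeff (g' n t) := fun n t =>
    Torus.isRealCoeff_mFourierCoeff hf.integrable
  have hg'_cont : ∀ n, Continuous (g' n) := fun n => continuous_const
  have hgfix : ∀ p ∈ G, ∀ (n : ℕ) (t : ℝ) (k : d → ℤ) (i : d),
      Torus.coeffExt _ (g' n t) (fun j => p.2.1 j * k (p.1 j)) i = mFourier (-fun j =>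
        p.2.1 j * k (p.1 j)) p.2.2 * ((p.2.1 i : ℂ) * Torus.coeffExt _ (g' n t) k (p.1 i)) := by
    intro p hp n t k i
    by_cases hk : k ∈ Torus.freqBall n
    · rw [Torus.coeffExt_of_mem _ ((hSQ p hp n k).2 hk), Torus.coeffExt_of_mem _ hk]
      exact mFourierCoeff_of_symmetric p.1 (hG p hp) (fun _ _ => rfl) p.2.2 hf.continuous (hfG p hp)
        k i
    · rw [Torus.coeffExt_of_not_mem _ (fun h => hk ((hSQ p hp n k).1 h)),
        Torus.coeffExt_of_not_mem _ hk]
      simp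
  -- the symmetric subspaces of the Galerkin phase spaces, invariant under the Galerkin field
  let W : (n : ℕ) → Submodule ℝ (↥(Torus.freqBall (d := d) n) → EuclideanSpace ℂ d) := fun n =>
    { carrier := {c | c ∈ galerkinSubspace (Torus.freqBall n) ∧ ∀ p ∈ G, ∀ (k : d → ℤ) (i : d),
        Torus.coeffExt _ c (fun j => p.2.1 j * k (p.1 j)) i = mFourier (-fun j =>
          p.2.1 j * k (p.1 j)) p.2.2 * ((p.2.1 i : ℂ) * Torus.coeffExt _ c k (p.1 i))}
      zero_mem' := ⟨Submodule.zero_mem _, fun p _ k i => by simp⟩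
      add_mem' := fun {c c'} hc hc' => ⟨Submodule.add_mem _ hc.1 hc'.1, fun p hp k i => by
        rw [Torus.coeffExt_add, Pi.add_apply, PiLp.add_apply, Pi.add_apply, PiLp.add_apply,
          hc.2 p hp k i, hc'.2 p hp k i]
        ring⟩
      smul_mem' := fun a c hc => ⟨Submodule.smul_mem _ a hc.1, fun p hp k i => by
        rw [Torus.coeffExt_smul, Pi.smul_apply, PiLp.smul_apply, Pi.smul_apply, PiLp.smul_apply,
          hc.2 p hp k i]
        simp only [Complex.real_smul]
        ring⟩ }
  have hWle : ∀ n, W n ≤ galerkinSubspace (Torus.freqBall n) := fun n c hc => hc.1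
  have hWinv : ∀ n t, ∀ c ∈ W n, galerkinRHS (Torus.freqBall n) ν (g' n t) c ∈ W n := by
    intro n t c hc
    refine ⟨galerkinRHS_mem ν (hS n) (hg'_real n t) hc.1, fun p hp k i => ?_⟩
    by_cases hk : k ∈ Torus.freqBall n
    · rw [Torus.coeffExt_of_mem _ ((hSQ p hp n k).2 hk), Torus.coeffExt_of_mem _ hk,
        galerkinRHS_apply, galerkinRHS_apply]
      exact galerkinField_signedPerm p.1 (hG p hp) (fun _ _ => rfl) ν (hSQ p hp n) (hφ p hp)
        (hgfix p hp n t) (hc.2 p hp) k i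
    · rw [Torus.coeffExt_of_not_mem _ (fun h => hk ((hSQ p hp n k).1 h)),
        Torus.coeffExt_of_not_mem _ hk]
      simp
  -- the global Galerkin solutions from rest
  have hsol : ∀ n : ℕ, ∃ α : ℝ → ↥(Torus.freqBall (d := d) n) → EuclideanSpace ℂ d,
      α 0 = 0 ∧ (∀ t, α t ∈ W n) ∧ ContinuousOn α (Ici 0) ∧ ∀ T, ∀ t ∈ Icc 0 T,
        HasDerivWithinAt α (galerkinRHS (Torus.freqBall n) ν (g' n t) (α t)) (Icc 0 T) t := fun n =>
    exists_galerkin_solution_of_invariant ν hν.le (hS n) (hg'_cont n) (hg'_real n) (W n) (hWle n)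
      (hWinv n) (Submodule.zero_mem _)
  choose α hα0 hαW hαcont hαderiv using hsol
  have hαmem : ∀ n t, α n t ∈ galerkinSubspace (Torus.freqBall n) := fun n t => hWle n (hαW n t)
  have hU0 : ∀ n, Torus.realTrigPoly (Torus.freqBall n) (Torus.coeffExt _ (α n 0)) = 0 := fun n => by
    rw [hα0 n, Torus.coeffExt_zero, Torus.realTrigPoly_zero]
  have hF : ∀ n t, Torus.realTrigPoly (Torus.freqBall n) (Torus.coeffExt _ (g' n t)) =
      Torus.fourierTruncate n f := fun n t => by
    rw [Torus.fourierTruncate_eq]; exact Torus.realTrigPoly_coeffExt_restrict _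
  refine ⟨id, fun n t => Torus.realTrigPoly (Torus.freqBall n) (Torus.coeffExt _ (g' n t)),
    fun n t => Torus.realTrigPoly (Torus.freqBall n) (Torus.coeffExt _ (α n t)), ?_, fun n t p hp => ?_⟩
  · exact
      { tendsto_order := tendsto_id
        smooth_force := fun n => Torus.contDiff_stLift_realTrigPoly contDiff_const
        tendsto_force := fun T hT => by
          simp_rw [hF, setLIntegral_const]
          have h := ENNReal.Tendsto.mul_const (b := volume (Ioo (0 : ℝ) T))
            (Torus.tendsto_lintegral_enorm_sq_fourierTruncate_sub (hf.memLp 2))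
            (Or.inr measure_Ioo_lt_top.ne)
          rwa [zero_mul] at h
        continuousOn := fun n => continuousOn_stLift_realTrigPoly (hαcont n)
        isGalerkinMode := fun n t _ =>
          have h := galerkin_slice_props (hS n) (hαmem n t)
          ⟨h.1, h.2.1, fun k hk => h.2.2.2 k (Torus.not_mem_freqBall.2 hk)⟩
        isWeaklyDivFree := fun n t _ => (galerkin_slice_props (hS n) (hαmem n t)).2.2.1
        galerkin := fun n a ha s t hs hst =>
          galerkin_test_identity ν (hS n) (hg'_cont n) (hg'_real n) (hαmem n) (hαderiv n)
            ha.isSmooth ha.isDivFree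
            (fun k hk => ha.mFourierCoeff_eq_zero (Torus.not_mem_freqBall.1 hk)) hs hst
        energy_eq := fun n s t hs hst =>
          galerkin_energy_identity ν (hS n) (hg'_cont n) (hg'_real n) (hαmem n) (hαderiv n) hs hst
        initial_inner := fun n a ha => by rw [hU0 n]
        tendsto_initial := by simp_rw [hU0, sub_zero, eLpNorm_zero]; exact tendsto_const_nhds }
  · -- covariance of the approximations: their coefficients are `coeffExt (α n t)`, in `W n`
    refine symmetric_of_mFourierCoeff p.1 (hG p hp) (fun _ _ => rfl) p.2.2
      (Torus.continuous_realTrigPoly _ _) fun k i => ?_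
    have hcoef : ∀ k : d → ℤ, mFourierCoeff (EuclideanSpace.complexify ∘
        Torus.realTrigPoly (Torus.freqBall n) (Torus.coeffExt _ (α n t))) k = Torus.coeffExt _ (α n t) k :=
      fun k => by
      rw [Torus.mFourierCoeff_realTrigPoly (hS n) ((hαmem n t).1.isConjSymm_coeffExt (hS n))]
      by_cases hk : k ∈ Torus.freqBall n
      · rw [if_pos hk]
      · rw [if_neg hk, Torus.coeffExt_of_not_mem _ hk]
    rw [hcoef, hcoef]
    exact (hαW n t).2 p hp k i

/-- `IsGPSymmetric` is covariance under the list of the three generators of `G` written as affine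
symmetries `(σ, ε, b)`: `(j ↦ j+1, 1, 0)`, `(1, -1, 0)`, `(1, (1,-1,-1), (½,0,½))`. [folklore] -/
theorem isGPSymmetric_iff (u : UnitAddTorus (Fin 3) → EuclideanSpace ℝ (Fin 3)) :
    IsGPSymmetric u ↔ ∀ p ∈ ([(Equiv.addRight 1, fun _ => 1, 0), (Equiv.refl _, fun _ => -1, 0),
        (Equiv.refl _, ![1, -1, -1], ![halfPeriod, 0, halfPeriod])] :
          List (Equiv.Perm (Fin 3) × (Fin 3 → ℤ) × UnitAddTorus (Fin 3))),
      ∀ (y : UnitAddTorus (Fin 3)) (i : Fin 3),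
        u (fun j => p.2.1 j • y (p.1 j) + p.2.2 j) i = (p.2.1 i : ℝ) * u y (p.1 i) := by
  have hA1 : ∀ y : UnitAddTorus (Fin 3), (fun j => (1 : ℤ) • y (Equiv.addRight (1 : Fin 3) j) +
      (0 : UnitAddTorus (Fin 3)) j) = cycShift y := fun y => by funext j; simp [cycShift]
  have hA2 : ∀ y : UnitAddTorus (Fin 3), (fun j => (-1 : ℤ) • y (Equiv.refl (Fin 3) j) +
      (0 : UnitAddTorus (Fin 3)) j) = -y := fun y => by funext j; simp
  have hA3 : ∀ y : UnitAddTorus (Fin 3), (fun j => (![1, -1, -1] : Fin 3 → ℤ) j •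
      y (Equiv.refl (Fin 3) j) + (![halfPeriod, 0, halfPeriod] : UnitAddTorus (Fin 3)) j) =
        twistTurn y := fun y => by funext j; fin_cases j <;> simp [twistTurn]
  simp only [List.mem_cons, List.not_mem_nil, or_false, forall_eq_or_imp, forall_eq]
  constructor
  · rintro ⟨h1, h2, h3⟩
    refine ⟨fun y i => ?_, fun y i => ?_, fun y i => ?_⟩
    · rw [hA1]; simpa using h1 y i
    · rw [hA2]; simpa using h2 y i
    · rw [hA3]; fin_cases i <;> simp [h3 y]
  · rintro ⟨h1, h2, h3⟩
    refine ⟨fun y i => ?_, fun y i => ?_, fun y => ⟨?_, ?_, ?_⟩⟩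
    · have h := h1 y i; rw [hA1] at h; simpa using h
    · have h := h2 y i; rw [hA2] at h; simpa using h
    · have h := h3 y 0; rw [hA3] at h; simpa using h
    · have h := h3 y 1; rw [hA3] at h; simpa using h
    · have h := h3 y 2; rw [hA3] at h; simpa using h

end StubSymmetricScheme

/-- **S5 `stub_symmetricScheme`**. For every `ν > 0` there is a Hopf–Galerkin scheme for
`(ν, f_GP, 0)` (steady force `t ↦ f_GP`, datum `0`) all of whose approximants `U n t`, `t ≥ 0`, are
`G`-symmetric: the Galerkin vector field is `G`-equivariant (the Stokes operator, the Leray symbol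
and the frequency balls commute with signed coordinate permutations, half-translations act by signs
on Fourier coefficients) so the scheme runs in the closed subspace of symmetric coefficient vectors
(`exists_galerkin_solution_of_invariant`, pattern `exists_isHopfGalerkinScheme_invariant`). [folklore] -/
theorem stub_symmetricScheme :
    ∀ ν : ℝ, 0 < ν →
      ∃ (N : ℕ → ℕ) (F U : ℕ → ℝ → UnitAddTorus (Fin 3) → EuclideanSpace ℝ (Fin 3)),
        IsHopfGalerkinScheme ν (fun _ => gpForce) 0 N F U ∧
          ∀ n (t : ℝ), 0 ≤ t → IsGPSymmetric (U n t) := by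
  intro ν hν
  obtain ⟨N, F, U, hS, hU⟩ := StubSymmetricScheme.exists_symmetric_scheme ν hν _ (by
      simp only [List.mem_cons, List.not_mem_nil, or_false, forall_eq_or_imp, forall_eq]
      exact ⟨fun _ => by simp, fun _ => by simp, fun j => by fin_cases j <;> simp⟩)
    (Theorems.SteadyStatesLoudBounded.GpAdmissible.stub_gpAdmissible).1
    ((StubSymmetricScheme.isGPSymmetric_iff gpForce).1 StubHeadModes.isGPSymmetric_gpForce)
  exact ⟨N, F, U, hS, fun n t _ => (StubSymmetricScheme.isGPSymmetric_iff (U n t)).2 (hU n t)⟩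

end Summit.AnomalousDissipation.AnomalousDissipation.Theorems.EnsembleRigidity.GPMeanBoundedFamily

end
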